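import Summits.QuantumFields.YangMills.Theorems.ParabolicTrajectoryTunedSequenceExistsQFemtoBridge
import Summits.QuantumFields.YangMills.Theorems.ParabolicTrajectoryTunedSequenceExistsPairCeiling

/-!
# Crux `TunedSequenceExists` (stmt-QuantumFields-10524) vs the sibling crux `FemtoCurvatureTwoPointC`
# (stmt-QuantumFields-16204): no femto torus witnesses the crux AS FILED (the corner density `P`)
# (lead c5 of line `fixed-aspect-window`, `--supports stmt-QuantumFields-10524`)

The crux as filed asks for tuned `M`-adic Wilson schemes (`β_k → ∞`, torus side `2 L_k + 1`, aspect
`L_k / M^{n_k} → ∞`) whose rescaled corner-density correlator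
`u_k = (M^{n_k})⁸ ⟨P ; τ_{M^{n_k}} P⟩_{β_k, 2L_k+1}` converges to some `θ > 0`, where
`P = r.curvature.F = Σ_{i<j} Re tr r(U_{p_{ij}(0)})` is the Wilson action density (SIX plaquettes, all based at the
origin).  The sibling tier-deciding crux, unbundled at given data as `QFemto.CruxCAtWith r a Γ β₀ ℓ₀ c C`
(`…QFemtoBridge`), bounds in its clause 3 EVERY plaquette-pair covariance on a femto torus (`β ≥ β₀`,
`S · a β ≤ ℓ₀`) by `C · Γ(dist · a β) / dist⁸`, and its shape is forced to vanish at `0+`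
(`QFemto.gamma_tendsto_zero_of_cruxCAtWith`, for a continuous unit map `a`).  This file draws the consequences for
the corner density `P` of the crux AS FILED (the `Q`-channel analogue is `…QNonFemto`):

* `abs_cov_reTr_mul_le_gamma`, `abs_cov_axis_le_gamma` — one term, KEEPING the shape `Γ` (lead c4's
  `PairCeiling.abs_cov_reTr_le` / `abs_cov_axis_le` absorbed `Γ ≤ 1`): on a femto odd torus `2L+1`,
  `|cov(Re tr U_{∂p(0;i,j)}, Re tr U_{∂p(D e₀;i',j')})| ≤ C · Γ(D · a β) / D⁸` for `1 ≤ D ≤ L`;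
* `abs_rescaled_curvature_le_of_cruxCAtWith` — (a) ALL 36 terms of `⟨P ; τ_D P⟩_{β,2L+1}` are plaquette pairs at
  torus distance exactly `D` (sites `0` and `D e₀`, `D ≤ L`), so `D⁸ |⟨P ; τ_D P⟩_{β, 2L+1}| ≤ 36 · C · Γ(D · a β)`;
* `rescaled_curvature_lt_of_cruxCAtWith` — hence uniform smallness: for every `ε > 0` there is `δ > 0` with
  `D⁸ ⟨P ; τ_D P⟩_{β,2L+1} < ε` on every femto odd torus at every separation `1 ≤ D ≤ L` of physical size
  `D · a β < δ`;
* `eventually_not_femto_of_tuned` — (b) along ANY tuned witness OF THE CRUX AS FILED the tori are eventually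
  NON-femto in the sibling's units: `ℓ₀ < (2 L_k + 1) · a(β_k)` for all large `k` (the aspect `L_k / M^{n_k} → ∞`
  because `a_k L_k → ∞`, so a femto torus would have physical separation `M^{n_k} · a(β_k) < δ` and correlator
  below `θ / 2`).

So a tuned sequence can never stay inside the sibling route's femto universe: the formal reason why a
thermodynamic-limit child ((V) of the line `fixed-aspect-window`) is NECESSARY and not an artefact of the split.

References: Osterwalder–Seiler 1978 §2 (torus Wilson states, lattice symmetries).
-/

noncomputable section

open MeasureTheory ProbabilityTheory Finset Filter Topology
open Literature.MathematicalPhysics.QuantumFieldTheory hiding Site ZdEdge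
open Literature.MathematicalPhysics.QuantumLattice
open Literature.Probability.LatticeModels hiding configShift configShift_apply
open Summit.QuantumFields.YangMills.Theorems.FiniteSusceptibilityWeakCoupling

namespace Summit.QuantumFields.YangMills.Theorems.TunedSequenceExists.PNonFemto

open PairCeiling (torusDist_axis proj_single_ne abs_cov_sum_sum_le curvature_torusLift_eq_sum
  curvature_shift_torusLift_eq_sum)
open Negative.AtZeroFalse (eventually_sep_le_L)

variable {G : Type} [Group G] [TopologicalSpace G] [IsTopologicalGroup G] [CompactSpace G]
  [MeasurableSpace G] [BorelSpace G]

/-! ## One plaquette pair on a femto torus, keeping the shape `Γ` -/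

/-- **One term, keeping the shape.** Under `QFemto.CruxCAtWith r a Γ β₀ ℓ₀ c C`, on a femto odd torus `2L+1`
(`β ≥ β₀`, `(2L+1) · a β ≤ ℓ₀`) the covariance of two torus plaquette functions at sites `π x ≠ π y` satisfies
`|cov| · dist(π x, π y)⁸ ≤ C · Γ(dist(π x, π y) · a β)` — clause 3 of the sibling crux, stated there for the deficits
`N − Re tr`, whose covariance is the same. -/
theorem abs_cov_reTr_mul_le_gamma (r : LatticeRep G) {a Γ : ℝ → ℝ} {β₀ ℓ₀ c C : ℝ}
    (h : QFemto.CruxCAtWith r a Γ β₀ ℓ₀ c C) {β : ℝ} (hβ : β₀ ≤ β) {L : ℕ}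
    (hfem : ((2 * L + 1 : ℕ) : ℝ) * a β ≤ ℓ₀) (x y : Site 4) {i j i' j' : Fin 4}
    (hxy : Torus.proj (2 * L + 1) x ≠ Torus.proj (2 * L + 1) y) (hij : i ≠ j) (hij' : i' ≠ j') :
    |cov[fun U : GaugeConfig 4 (2 * L + 1) G =>
        (r.ρ (plaquetteHolonomy U (Torus.proj (2 * L + 1) x) i j)).trace.re,
      fun U => (r.ρ (plaquetteHolonomy U (Torus.proj (2 * L + 1) y) i' j')).trace.re;
      wilsonMeasure (d := 4) (L := 2 * L + 1) r.ρ β]| *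
      Real.sqrt (∑ k : Fin 4, (((Torus.proj (2 * L + 1) x k - Torus.proj (2 * L + 1) y k).valMinAbs
        : ℤ) : ℝ) ^ 2) ^ 8 ≤
      C * Γ (Real.sqrt (∑ k : Fin 4, (((Torus.proj (2 * L + 1) x k - Torus.proj (2 * L + 1) y k).valMinAbs
        : ℤ) : ℝ) ^ 2) * a β) := by
  haveI := isProbabilityMeasure_wilsonMeasure (d := 4) (L := 2 * L + 1) r.ρ r.continuous β
  have h3 := (h.2.2.2.2.2 (2 * L + 1) β hβ hfem).2 _ _ i j i' j' hxy hij hij'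
  -- the covariance of the deficits is the covariance of the plaquette functions
  have hA := PairCeiling.memLp_reTr_plaquetteHolonomy r β L x i j
  have hB := PairCeiling.memLp_reTr_plaquetteHolonomy r β L y i' j'
  have hcov : cov[fun U : GaugeConfig 4 (2 * L + 1) G =>
        (r.ρ (plaquetteHolonomy U (Torus.proj (2 * L + 1) x) i j)).trace.re,
      fun U => (r.ρ (plaquetteHolonomy U (Torus.proj (2 * L + 1) y) i' j')).trace.re;
      wilsonMeasure (d := 4) (L := 2 * L + 1) r.ρ β] =
      cov[fun U : GaugeConfig 4 (2 * L + 1) G =>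
        (r.N : ℝ) - (r.ρ (plaquetteHolonomy U (Torus.proj (2 * L + 1) x) i j)).trace.re,
      fun U => (r.N : ℝ) - (r.ρ (plaquetteHolonomy U (Torus.proj (2 * L + 1) y) i' j')).trace.re;
      wilsonMeasure (d := 4) (L := 2 * L + 1) r.ρ β] := by
    rw [covariance_const_sub_left (hA.integrable one_le_two),
      covariance_const_sub_right (hB.integrable one_le_two), neg_neg]
  have hA' : MemLp (fun U : GaugeConfig 4 (2 * L + 1) G =>
      (r.N : ℝ) - (r.ρ (plaquetteHolonomy U (Torus.proj (2 * L + 1) x) i j)).trace.re) 2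
      (wilsonMeasure (d := 4) (L := 2 * L + 1) r.ρ β) := (memLp_const _).sub hA
  have hB' : MemLp (fun U : GaugeConfig 4 (2 * L + 1) G =>
      (r.N : ℝ) - (r.ρ (plaquetteHolonomy U (Torus.proj (2 * L + 1) y) i' j')).trace.re) 2
      (wilsonMeasure (d := 4) (L := 2 * L + 1) r.ρ β) := (memLp_const _).sub hB
  have hsub := covariance_eq_sub hA' hB'
  rw [hcov, hsub]
  simpa only [wilsonExpectation, Pi.mul_apply] using h3

/-- **One on-axis term, keeping the shape.** Under `QFemto.CruxCAtWith r a Γ β₀ ℓ₀ c C`, on a femto odd torus `2L+1`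
the covariance of the torus plaquette functions at `π 0` and `π(D e₀)` with `1 ≤ D ≤ L` (torus distance exactly `D`)
is at most `C · Γ(D · a β) / D⁸` in absolute value. -/
theorem abs_cov_axis_le_gamma (r : LatticeRep G) {a Γ : ℝ → ℝ} {β₀ ℓ₀ c C : ℝ}
    (h : QFemto.CruxCAtWith r a Γ β₀ ℓ₀ c C) {β : ℝ} (hβ : β₀ ≤ β) {L D : ℕ}
    (hfem : ((2 * L + 1 : ℕ) : ℝ) * a β ≤ ℓ₀) (hD1 : 1 ≤ D) (hDL : D ≤ L) {i j i' j' : Fin 4}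
    (hij : i ≠ j) (hij' : i' ≠ j') :
    |cov[fun U : GaugeConfig 4 (2 * L + 1) G =>
        (r.ρ (plaquetteHolonomy U (Torus.proj (2 * L + 1) (Pi.single 0 (0 : ℤ))) i j)).trace.re,
      fun U => (r.ρ (plaquetteHolonomy U (Torus.proj (2 * L + 1) (Pi.single 0 (D : ℤ))) i' j')).trace.re;
      wilsonMeasure (d := 4) (L := 2 * L + 1) r.ρ β]| ≤ C * Γ ((D : ℝ) * a β) / (D : ℝ) ^ 8 := by
  have hab : (((0 : ℤ) - (D : ℤ) : ℤ) : ZMod (2 * L + 1)) = ((-(D : ℤ) : ℤ) : ZMod (2 * L + 1)) := by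
    rw [zero_sub]
  have hm : |(-(D : ℤ))| ≤ L := by
    rw [abs_neg, abs_of_nonneg (by omega)]; omega
  have hm1 : 1 ≤ |(-(D : ℤ))| := by
    rw [abs_neg, abs_of_nonneg (by omega)]; omega
  have h1 := abs_cov_reTr_mul_le_gamma r h hβ hfem (Pi.single 0 (0 : ℤ)) (Pi.single 0 (D : ℤ))
    (proj_single_ne L hab hm1 hm) hij hij'
  rw [torusDist_axis L hab hm] at h1
  have hDabs : |((-(D : ℤ) : ℤ) : ℝ)| = D := by
    push_cast
    rw [abs_neg, Nat.abs_cast]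
  rw [hDabs] at h1
  have hDpos : (0 : ℝ) < D := Nat.cast_pos.2 (by omega)
  rw [le_div_iff₀ (pow_pos hDpos 8)]
  exact h1

/-! ## (a) The rescaled corner-density correlator on a femto torus -/

/-- **(a) `D⁸ |⟨P ; τ_D P⟩_{β,2L+1}| ≤ 36 · C · Γ(D · a β)` on femto odd tori.** Under
`QFemto.CruxCAtWith r a Γ β₀ ℓ₀ c C`, for `β ≥ β₀`, `(2L+1) · a β ≤ ℓ₀` and `1 ≤ D ≤ L`: the connected correlator of
the corner density `P = r.curvature.F` (six plaquettes based at the origin) with its time translate `τ_D P` expands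
into 36 covariances of torus plaquette functions at the sites `π 0` and `π(D e₀)`, at torus distance exactly `D`,
each at most `C · Γ(D · a β) / D⁸` by clause 3 of the sibling crux. -/
theorem abs_rescaled_curvature_le_of_cruxCAtWith (r : LatticeRep G) {a Γ : ℝ → ℝ} {β₀ ℓ₀ c C : ℝ}
    (h : QFemto.CruxCAtWith r a Γ β₀ ℓ₀ c C) {β : ℝ} (hβ : β₀ ≤ β) {L D : ℕ}
    (hfem : ((2 * L + 1 : ℕ) : ℝ) * a β ≤ ℓ₀) (hD1 : 1 ≤ D) (hDL : D ≤ L) :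
    (D : ℝ) ^ 8 * |latticeConnectedCorr r.ρ β (2 * L + 1) r.curvature.F r.curvature.F D| ≤
      36 * C * Γ ((D : ℝ) * a β) := by
  have hcorr : latticeConnectedCorr r.ρ β (2 * L + 1) r.curvature.F r.curvature.F D =
      cov[fun U => r.curvature.F (torusLift (2 * L + 1) U),
        fun U => r.curvature.F (configShift (-(Pi.single 0 (D : ℤ))) (torusLift (2 * L + 1) U));
        wilsonMeasure (d := 4) (L := 2 * L + 1) r.ρ β] :=
    (SiblingFunnel.covariance_eq_latticeConnectedCorr r β r.curvature r.curvature L D).symm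
  rw [hcorr]
  -- the 36-term expansion
  have hfst : (fun U : GaugeConfig 4 (2 * L + 1) G => r.curvature.F (torusLift (2 * L + 1) U)) =
      fun U => ∑ q : {q : Fin 4 × Fin 4 // q.1 < q.2},
        (r.ρ (plaquetteHolonomy U (Torus.proj (2 * L + 1)
          ((fun _ : {q : Fin 4 × Fin 4 // q.1 < q.2} => (Pi.single 0 (0 : ℤ) : Site 4)) q))
          q.1.1 q.1.2)).trace.re := by
    funext U; exact curvature_torusLift_eq_sum r _ U
  have hsnd : (fun U : GaugeConfig 4 (2 * L + 1) G =>
        r.curvature.F (configShift (-(Pi.single 0 (D : ℤ))) (torusLift (2 * L + 1) U))) =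
      fun U => ∑ q : {q : Fin 4 × Fin 4 // q.1 < q.2},
        (r.ρ (plaquetteHolonomy U (Torus.proj (2 * L + 1)
          ((fun _ : {q : Fin 4 × Fin 4 // q.1 < q.2} => (Pi.single 0 (D : ℤ) : Site 4)) q))
          q.1.1 q.1.2)).trace.re := by
    funext U; exact curvature_shift_torusLift_eq_sum r _ _ U
  rw [hfst, hsnd]
  have hterm : ∀ q q' : {q : Fin 4 × Fin 4 // q.1 < q.2},
      |cov[fun U : GaugeConfig 4 (2 * L + 1) G =>
          (r.ρ (plaquetteHolonomy U (Torus.proj (2 * L + 1)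
            ((fun _ : {q : Fin 4 × Fin 4 // q.1 < q.2} => (Pi.single 0 (0 : ℤ) : Site 4)) q))
            q.1.1 q.1.2)).trace.re,
        fun U => (r.ρ (plaquetteHolonomy U (Torus.proj (2 * L + 1)
          ((fun _ : {q : Fin 4 × Fin 4 // q.1 < q.2} => (Pi.single 0 (D : ℤ) : Site 4)) q'))
          q'.1.1 q'.1.2)).trace.re;
        wilsonMeasure (d := 4) (L := 2 * L + 1) r.ρ β]| ≤ C * Γ ((D : ℝ) * a β) / (D : ℝ) ^ 8 := by
    intro q q'
    have hq : q.1.1 ≠ q.1.2 := fun he => by have := q.2; rw [he] at this; exact lt_irrefl _ this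
    have hq' : q'.1.1 ≠ q'.1.2 := fun he => by have := q'.2; rw [he] at this; exact lt_irrefl _ this
    exact abs_cov_axis_le_gamma r h hβ hfem hD1 hDL hq hq'
  have hsum := abs_cov_sum_sum_le r β L _ _ hterm
  have hDpos : (0 : ℝ) < D := Nat.cast_pos.2 (by omega)
  have hD8 : (0 : ℝ) < (D : ℝ) ^ 8 := pow_pos hDpos 8
  calc (D : ℝ) ^ 8 * |cov[_, _; wilsonMeasure (d := 4) (L := 2 * L + 1) r.ρ β]|
      ≤ (D : ℝ) ^ 8 * (36 * (C * Γ ((D : ℝ) * a β) / (D : ℝ) ^ 8)) :=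
        mul_le_mul_of_nonneg_left hsum hD8.le
    _ = 36 * C * Γ ((D : ℝ) * a β) * ((D : ℝ) ^ 8 / (D : ℝ) ^ 8) := by ring
    _ = 36 * C * Γ ((D : ℝ) * a β) := by rw [div_self hD8.ne', mul_one]

/-! ## (b) Tuned witnesses of the crux as filed live on non-femto tori -/

/-- **Uniform smallness on femto tori at small physical separation (corner density).** Under
`QFemto.CruxCAtWith r a Γ β₀ ℓ₀ c C` with `a` continuous, for every `ε > 0` there is `δ > 0` such that on every femto
odd torus (`β ≥ β₀`, `(2L+1) · a β ≤ ℓ₀`) every separation `1 ≤ D ≤ L` of physical size `D · a β < δ` has rescaled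
corner-density correlator `D⁸ ⟨P ; τ_D P⟩_{β,2L+1} < ε` (part (a): `≤ 36 C · Γ(D · a β) ≤ max (36 C) 1 · Γ(D · a β)`,
and the forced `Γ(0+) = 0`). -/
theorem rescaled_curvature_lt_of_cruxCAtWith (r : LatticeRep G) {a Γ : ℝ → ℝ} {β₀ ℓ₀ c C : ℝ}
    (h : QFemto.CruxCAtWith r a Γ β₀ ℓ₀ c C) (ha : Continuous a) {ε : ℝ} (hε : 0 < ε) :
    ∃ δ : ℝ, 0 < δ ∧ ∀ (β : ℝ) (L D : ℕ), β₀ ≤ β → ((2 * L + 1 : ℕ) : ℝ) * a β ≤ ℓ₀ → 1 ≤ D → D ≤ L →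
      (D : ℝ) * a β < δ →
        (D : ℝ) ^ 8 * latticeConnectedCorr r.ρ β (2 * L + 1) r.curvature.F r.curvature.F D < ε := by
  have hapos := h.2.2.1
  have hΓ := h.2.2.2.2.1
  -- absorb the sign of `C` into `K = max (36 C) 1 > 0`
  set K : ℝ := max (36 * C) 1 with hK_def
  have hK : 0 < K := lt_of_lt_of_le one_pos (le_max_right _ _)
  have hCK : 36 * C ≤ K := le_max_left _ _
  have hεK : 0 < ε / K := div_pos hε hK
  obtain ⟨δ, hδ, hΓδ⟩ :=
    Metric.tendsto_nhdsWithin_nhds.1 (QFemto.gamma_tendsto_zero_of_cruxCAtWith r h ha) (ε / K) hεK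
  refine ⟨δ, hδ, fun β L D hβ hfem hD1 hDL hsδ => ?_⟩
  -- the physical separation `s = D · a β ∈ (0, ℓ₀]`, `s < δ`
  set s : ℝ := (D : ℝ) * a β with hs_def
  have hDpos : (0 : ℝ) < D := Nat.cast_pos.2 hD1
  have hs : 0 < s := mul_pos hDpos (hapos β)
  have hsℓ : s ≤ ℓ₀ := by
    have hDS' : (D : ℝ) ≤ ((2 * L + 1 : ℕ) : ℝ) := by exact_mod_cast (by omega : D ≤ 2 * L + 1)
    calc s = (D : ℝ) * a β := rfl
      _ ≤ ((2 * L + 1 : ℕ) : ℝ) * a β := mul_le_mul_of_nonneg_right hDS' (hapos β).le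
      _ ≤ ℓ₀ := hfem
  have hΓs : Γ s < ε / K := by
    have h1 := hΓδ (Set.mem_Ioi.2 hs) (by rwa [dist_zero_right, Real.norm_eq_abs, abs_of_pos hs])
    rw [dist_zero_right, Real.norm_eq_abs] at h1
    exact (abs_lt.1 h1).2
  have hΓpos : 0 < Γ s := (hΓ s hs hsℓ).1
  -- part (a) on the femto torus of side `2L+1` at separation `D`
  have hwin := abs_rescaled_curvature_le_of_cruxCAtWith r h hβ hfem hD1 hDL
  calc (D : ℝ) ^ 8 * latticeConnectedCorr r.ρ β (2 * L + 1) r.curvature.F r.curvature.F D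
      ≤ (D : ℝ) ^ 8 * |latticeConnectedCorr r.ρ β (2 * L + 1) r.curvature.F r.curvature.F D| :=
        mul_le_mul_of_nonneg_left (le_abs_self _) (by positivity)
    _ ≤ 36 * C * Γ s := hwin
    _ ≤ K * Γ s := mul_le_mul_of_nonneg_right hCK hΓpos.le
    _ < K * (ε / K) := mul_lt_mul_of_pos_left hΓs hK
    _ = ε := mul_div_cancel₀ ε hK.ne'

/-- **(b) Along any tuned witness of the crux as filed the tori are eventually non-femto.** Under
`QFemto.CruxCAtWith r a Γ β₀ ℓ₀ c C` with `a` continuous: if a Wilson scheme `sch` with `M`-adic shape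
`a_k = M^{-n_k}` and `β_k → ∞` has rescaled corner-density correlator
`(M^{n_k})⁸ ⟨P ; τ_{M^{n_k}} P⟩_{β_k, 2L_k+1} → θ > 0` (`P = r.curvature.F`), then eventually
`ℓ₀ < (2 L_k + 1) · a(β_k)`: the witnessing tori are NOT femto in the sibling's units. (Eventually `β_k ≥ β₀`,
`N · M^{n_k} ≤ L_k` for any `N` (`a_k L_k → ∞`), and the correlator exceeds `θ / 2`; were the torus femto, the
physical separation would be `M^{n_k} · a(β_k) ≤ ℓ₀ M^{n_k} / (2 L_k + 1) < δ`, forcing the correlator below `θ / 2` by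
`rescaled_curvature_lt_of_cruxCAtWith`. `2 ≤ M` is not needed: `M^{n_k} ≥ 1` by the shape clause and `a_k > 0`.) -/
theorem eventually_not_femto_of_tuned (r : LatticeRep G) {a Γ : ℝ → ℝ} {β₀ ℓ₀ c C : ℝ}
    (h : QFemto.CruxCAtWith r a Γ β₀ ℓ₀ c C) (ha : Continuous a) {M : ℕ} {θ : ℝ} (hθ : 0 < θ)
    (sch : SpeciesScheme (YMSpecies G)) (n : ℕ → ℕ) (hshape : ∀ k, sch.a k = ((M : ℝ) ^ n k)⁻¹)
    (hβ : Tendsto sch.β atTop atTop)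
    (hlim : Tendsto (fun k => ((M : ℝ) ^ n k) ^ 8 *
      latticeConnectedCorr r.ρ (sch.β k) (sch.side k) r.curvature.F r.curvature.F (M ^ n k)) atTop (𝓝 θ)) :
    ∀ᶠ k in atTop, ℓ₀ < (sch.side k : ℝ) * a (sch.β k) := by
  have hθ2 : 0 < θ / 2 := by positivity
  obtain ⟨δ, hδ, hsmall⟩ := rescaled_curvature_lt_of_cruxCAtWith r h ha hθ2
  -- aspect `N` with `ℓ₀ / (2 N) < δ`
  obtain ⟨N, hN⟩ := exists_nat_gt (ℓ₀ / (2 * δ))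
  have hδN : ℓ₀ < 2 * δ * N := by
    have h2 := (div_lt_iff₀ (by positivity : (0 : ℝ) < 2 * δ)).1 hN
    linarith
  have hθθ : θ / 2 < θ := by linarith
  filter_upwards [tendsto_atTop.1 hβ β₀, eventually_sep_le_L sch hshape 1, eventually_sep_le_L sch hshape N,
    hlim.eventually (lt_mem_nhds hθθ)] with k hk₀ hk1 hkN hku
  have hku' : θ / 2 < ((M : ℝ) ^ n k) ^ 8 *
      latticeConnectedCorr r.ρ (sch.β k) (sch.side k) r.curvature.F r.curvature.F (M ^ n k) := hku
  rw [← not_le]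
  intro hfem
  -- the separation `D = M^{n_k} ≥ 1` (the shape clause and `a_k > 0`), `D ≤ L_k`
  have hDpos : (0 : ℝ) < (M : ℝ) ^ n k := by
    have h1 := sch.a_pos k
    rw [hshape k, inv_pos] at h1
    exact h1
  have hD0 : 0 < M ^ n k := by exact_mod_cast hDpos
  have hDL : M ^ n k ≤ sch.L k := by omega
  have hcast : ((M ^ n k : ℕ) : ℝ) = (M : ℝ) ^ n k := Nat.cast_pow M (n k)
  have hS : ((sch.side k : ℕ) : ℝ) = 2 * (sch.L k : ℝ) + 1 := by
    simp [SpeciesScheme.side]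
  have hfemL : ((2 * sch.L k + 1 : ℕ) : ℝ) * a (sch.β k) ≤ ℓ₀ := hfem
  -- were the torus femto, the physical separation would be `< δ`
  have hsδ : ((M ^ n k : ℕ) : ℝ) * a (sch.β k) < δ := by
    rw [hcast]
    have hfem' := hfem
    rw [hS] at hfem'
    have hkN' : (N : ℝ) * (M : ℝ) ^ n k ≤ sch.L k := by exact_mod_cast hkN
    have hLpos : (0 : ℝ) < 2 * (sch.L k : ℝ) + 1 := by positivity
    by_contra hge
    push Not at hge
    have h1 : δ * (2 * (sch.L k : ℝ) + 1) ≤ (M : ℝ) ^ n k * a (sch.β k) * (2 * (sch.L k : ℝ) + 1) :=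
      mul_le_mul_of_nonneg_right hge hLpos.le
    have h2 : (M : ℝ) ^ n k * a (sch.β k) * (2 * (sch.L k : ℝ) + 1) ≤ (M : ℝ) ^ n k * ℓ₀ := by
      have := mul_le_mul_of_nonneg_left hfem' hDpos.le
      linarith
    have h3 : (M : ℝ) ^ n k * ℓ₀ < δ * (2 * (sch.L k : ℝ) + 1) := by
      nlinarith [mul_pos (sub_pos.2 hδN) hDpos,
        mul_le_mul_of_nonneg_left hkN' (by positivity : (0 : ℝ) ≤ 2 * δ)]
    linarith
  -- … forcing the rescaled correlator below `θ / 2`, contradiction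
  have hlt := hsmall (sch.β k) (sch.L k) (M ^ n k) hk₀ hfemL hD0 hDL hsδ
  rw [hcast] at hlt
  have hlt' : ((M : ℝ) ^ n k) ^ 8 *
      latticeConnectedCorr r.ρ (sch.β k) (sch.side k) r.curvature.F r.curvature.F (M ^ n k) < θ / 2 := hlt
  linarith

end Summit.QuantumFields.YangMills.Theorems.TunedSequenceExists.PNonFemto

end
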